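/-
Copyright (c) 2026. All rights reserved.
Released under Apache 2.0 license as described in the file LICENSE.
Authors: abc-iut cell, prover seat abc-iut-f-066 (gen 8; row «F3081 BUILD r1» B2a, abc-iut-L4-lead m211/m212), over this
seat's `LogFrobeniusRealisesRelLiftsTS.lean` (B1), abc-iut-f-102's `LogFrobeniusHolomorphicOverData.lean` (`coreLift`),
abc-iut-w5-d144's `LogFrobeniusObservablesTSOver.lean` (`logTSOverE`), abc-iut-L4-t12's over-data toolkit
(`DiagramOverHomotopies`, `DiagramOverTransport`, `DiagramShiftInvarianceLifts`) — every input consumed BY NAME.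
-/
import Literature.AnabelianGeometry.AbsoluteAnabelian.LogFrobeniusRealisesRelLiftsTS
import Literature.AnabelianGeometry.AbsoluteAnabelian.LogFrobeniusObservablesTSOver
import Literature.AnabelianGeometry.AbsoluteAnabelian.DiagramShiftInvarianceLifts
import HarnessLib

/-!
# [AbsTopIII] Cor 5.5 (iii) on `D•⊢`: a `TS`-observable homotopy lying over `Th•[Z]`, pushed into a core vertex, IS the core homotopy

S. Mochizuki, *Topics in absolute anabelian geometry III: global reconstruction algorithms* [MochizukiAbsTopIII2015];
locators `p.N` = pages of the author's manuscript (`paper:url-5493eb38cbb7`), read on the page: Cor 5.5 (iii) p. 131 (the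
observables are "compatible … with the families of homotopies that constitute the core … structures of (i)"), Rmk 3.5.1
p. 78 (a core as "a sort of 'constant portion' of the diagram that lies, in a consistent fashion, 'under the entire diagram'"),
Def 3.5 (ii) p. 75.

PROOF-SIDE bookkeeping for F-3081 (`Cor55ObservablesCompatible`, abc-iut-L4-t3), brick B2a of this seat's line.  abc-iut-f-102's
family `K₁ = relFamily (realisesRelLifts A Ξ …)` assigns to every pair of paths into a core vertex `ℰ•`, `An•[𝒳]`, `ℰ•` the core
homotopy `coreLift A Ξ` (the unique transformation over `Th•[Z]` through the fully faithful structure functor there).  For the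
union with the `TS`-pivots `𝒩_v` of B1 (abc-iut-f-101's `RelLifts.union`) the CROSS LAW from `𝒩_v` into the cores is needed: a
related pair `(P, Q)` at `𝒩_v` (a lifting pair of the `TS`-observable family `Hts v`) post-composed with `[t] : 𝒩_v → ⋯ → core`
has core homotopy EQUAL to the whiskered `TS`-homotopy.  This holds — and only holds (Rmk 3.5.1) — when the `TS`-homotopies
LIE OVER `Th•[Z]`, abc-iut-w5-d144's `(L.logTSOverE v).IsOver p q ((Hts v).η h)` (their `isOver_logObsFamilyTS_η` at the carriers).
Here, with `A := lamOver`, `Ξ := logOver` (abc-iut-L4-t3's print-faithful over-data):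
* §1 the portion presentation embedded in abc-iut-f-102's holomorphic sub-diagram (`embHolTS`; definitionally the same
  restricted diagram as along B1's `embExt`), `holLift` of an embedded path = the embedded path (`holLift_mapPath_embExt`);
* §2 `logTSOverE v` post-composed with `T = κ_{An•} ⋙ κ₂` IS `holOverData lamOver logOver` restricted to the portion
  (`logTSOverE_map_heq_holOverData`: vertex by vertex, arrow by arrow — the over-isomorphisms of both are `logOver`, unitors,
  `lamOver`, identities);
* §3 hence a `TS`-homotopy over `Th•[Z]` is, read in the holomorphic sub-diagram, over `holOverData` (`isOver_holOverData_of_isOver`),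
  stays so after whiskering into a core (abc-iut-L4-t12's `IsOver.whiskerRight`), and is therefore THE core homotopy
  (`IsOver.eq_lift`, `coreLift_heq_lift`): ★ `coreLift_comp_heq_whiskerRight_of_isOver` and, for B1's datum,
  ★ `tsRelLifts_θ_cross_core`.
HONEST LABEL: MODEL-LEVEL bookkeeping over OUR typed interface; refereed pre-IUT material; nothing here bears on [IUTchIII]
Cor. 3.12; no side taken; typed ≠ proved.
-/

set_option autoImplicit false

universe u

open CategoryTheory Quiver

namespace Literature.AnabelianGeometry.AbsoluteAnabelian

namespace LogFrobeniusSetting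

open DiagramOfCategories

variable {Vmod : Type u} {isArc : Vmod → Bool} (L : LogFrobeniusSetting Vmod isArc)

/-! ## §0. Bookkeeping -/

section Helpers

/-- right whiskering respects heterogeneous equality, along equal functors (bookkeeping). [folklore] -/
private theorem whiskerRight_heq_whiskerRight {A B C : Type*} [Category A] [Category B] [Category C] {F G F' G' : A ⥤ B}
    (hF : F = F') (hG : G = G') {α : F ⟶ G} {α' : F' ⟶ G'} (h : HEq α α') {K K' : B ⥤ C} (hK : K = K') :
    HEq (Functor.whiskerRight α K) (Functor.whiskerRight α' K') := by
  subst hF hG hK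
  cases h
  rfl

/-- over-ness along an equality of diagrams with (heterogeneously) equal structure data (abc-iut-L4-t12's `isOver_cast_iff`,
re-derived to keep the imports light). [cite: MochizukiAbsTopIII2015, Definition 3.5 (ii) p.75] -/
private theorem isOver_cast_iff' {V : Type u} [Quiver.{u} V] {C : Type (u + 1)} [Category.{u} C]
    {D₁ D₂ : DiagramOfCategories.{u, u + 1, u} V} (hD : D₁ = D₂) {O₁ : D₁.OverData C} {O₂ : D₂.OverData C}
    (hO : HEq O₁ O₂) {a b : V} {P Q : Path a b} {θ₁ : D₁.pathFunctor P ⟶ D₁.pathFunctor Q}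
    {θ₂ : D₂.pathFunctor P ⟶ D₂.pathFunctor Q} (hθ : HEq θ₁ θ₂) : O₁.IsOver P Q θ₁ ↔ O₂.IsOver P Q θ₂ := by
  subst hD
  cases hO
  cases hθ
  exact Iff.rfl

/-- right whiskering commutes with `eqToHom` (bookkeeping). [folklore] -/
private theorem whiskerRight_eqToHom_eq {A B C : Type*} [Category A] [Category B] [Category C] {F G : A ⥤ B} (e : F = G)
    (N : B ⥤ C) : Functor.whiskerRight (eqToHom e) N = eqToHom (by rw [e]) := by
  subst e
  rw [eqToHom_refl, eqToHom_refl, Functor.whiskerRight_id']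

/-- over-ness along `F^*` (abc-iut-L4-t12's `isOver_comapAlong_iff`, one direction, re-derived to keep the imports light).
[cite: MochizukiAbsTopIII2015, Definition 3.5 (ii) p.75] -/
private theorem isOver_of_isOver_comapAlong {V' : Type u} [Quiver.{u} V'] {V : Type u} [Quiver.{u} V] {C : Type (u + 1)}
    [Category.{u} C] {D : DiagramOfCategories.{u, u + 1, u} V} (O : D.OverData C) (F : V' ⥤q V) {a b : V'} (P Q : Path a b)
    (θ : (D.comapAlong F).pathFunctor P ⟶ (D.comapAlong F).pathFunctor Q) (h : (O.comapAlong F).IsOver P Q θ) :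
    O.IsOver (F.mapPath P) (F.mapPath Q)
      (eqToHom (D.pathFunctor_comapAlong F P).symm ≫ θ ≫ eqToHom (D.pathFunctor_comapAlong F Q)) := by
  unfold OverData.IsOver at h ⊢
  rw [O.pathIso_comapAlong F P, O.pathIso_comapAlong F Q] at h
  rw [Functor.whiskerRight_comp, Functor.whiskerRight_comp, whiskerRight_eqToHom_eq, whiskerRight_eqToHom_eq, h]
  simp only [Iso.trans_hom, Iso.trans_inv, eqToIso.hom, eqToIso.inv, Category.assoc, eqToHom_trans, eqToHom_refl,
    Category.comp_id, eqToHom_trans_assoc, Category.id_comp]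

end Helpers

/-! ## §1. The portion presentation inside the holomorphic sub-diagram -/

section Embedding

variable (v : Vmod)

/-- The vertices of the portion `D•_{≤2} ∪ {𝒩⊞_v}` and `𝒩_v` are holomorphic (vertices of `D•` proper).
[cite: MochizukiAbsTopIII2015, Cor 5.5 p. 130] -/
theorem isHolomorphic_embExt_obj (a' : (logShapeTS (isArc := isArc) v).Vertex) :
    ((embExt (InPortionThree (isArc := isArc) v) (.nv v)).obj a').IsHolomorphic := by
  cases a' with
  | base a =>
    rcases a.2 with ⟨hh, -⟩ | h
    · exact hh
    · exact (h ▸ trivial : (a.1).IsHolomorphic)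
  | obs => trivial

/-- `Γ⃗_{D•_{≤2} ∪ {𝒩⊞_v} ∪ {𝒩_v}} ↪ Γ⃗_{D•}` (into abc-iut-f-102's holomorphic sub-graph): B1's `embExt` with its values
certified holomorphic. [cite: MochizukiAbsTopIII2015, Cor 5.5 p. 130] -/
def embHolTS : (logShapeTS (isArc := isArc) v).Vertex ⥤q DSub (DVertex.IsHolomorphic (Vmod := Vmod) (isArc := isArc)) where
  obj a' := ⟨(embExt (InPortionThree (isArc := isArc) v) (.nv v)).obj a', isHolomorphic_embExt_obj v a'⟩
  map e := (embExt (InPortionThree (isArc := isArc) v) (.nv v)).map e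

/-- Restricting `D•` along `embHolTS` is restricting `D•⊢` along `embExt` (definitionally).
[cite: MochizukiAbsTopIII2015, Definition 3.5 (i) p.75] -/
theorem comapAlong_embHolTS :
    (L.subdiagram DVertex.IsHolomorphic).comapAlong (embHolTS (isArc := isArc) v) =
      L.diagram.comapAlong (embExt (InPortionThree (isArc := isArc) v) (.nv v)) :=
  rfl

/-- The presentation `D•_{≤2} ∪ {𝒩⊞_v} ∪ {𝒩_v}` IS `D•` restricted along `embHolTS` (abc-iut-f-102's `extend_eq_comapAlong`).
[cite: MochizukiAbsTopIII2015, Definition 3.5 (i) p.75] -/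
theorem logDiagramTS_eq_comapAlong_embHolTS :
    L.logDiagramTS v = (L.subdiagram DVertex.IsHolomorphic).comapAlong (embHolTS (isArc := isArc) v) :=
  L.extend_eq_comapAlong (InPortionThree v) (.nv v)

/-- The holomorphic lift of an embedded path is the path embedded into the holomorphic sub-graph.
[cite: MochizukiAbsTopIII2015, Cor 5.5 p. 130] -/
theorem holLift_mapPath_embExt {a' b' : (logShapeTS (isArc := isArc) v).Vertex} (p : Path a' b') :
    holLift ((embExt (InPortionThree (isArc := isArc) v) (.nv v)).mapPath p) (isHolomorphic_embExt_obj v b') =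
      (embHolTS (isArc := isArc) v).mapPath p := by
  induction p with
  | nil => rfl
  | cons p e ih =>
    change (holLift ((embExt (InPortionThree (isArc := isArc) v) (.nv v)).mapPath p) _).cons _ = ((embHolTS v).mapPath p).cons _
    rw [ih]
    rfl

end Embedding

/-! ## §2. `logTSOverE v` through `T = κ_{An•} ⋙ κ₂` is `holOverData lamOver logOver` on the portion -/

section OverDataComparison

variable (v : Vmod)

/-- abc-iut-L4-t3's print-faithful over-datum `A := lamOver` in the shape abc-iut-f-102's THEOREM B consumes.
[cite: MochizukiAbsTopIII2015, Def 5.4 (iv) p. 127] -/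
abbrev lamOverData : ∀ (v : Vmod) (ν : LogVertex (isArc v)), ν.isPostLog = false →
    (L.lam v ν ⋙ L.forget v ⋙ L.toE v ≅ L.proj) :=
  fun v ν _ => L.lamOver v ν

/-- Vertex by vertex: the structure functor of `logTSOverE v` followed by `T` is abc-iut-f-102's `holN`.
[cite: MochizukiAbsTopIII2015, Remark 3.5.1 p.78] -/
theorem logTSOverE_N_comp_T_heq (a' : (logShapeTS (isArc := isArc) v).Vertex) :
    HEq ((L.logTSOverE v).N a' ⋙ L.κAn.functor ⋙ L.κAn₂.functor)
      (L.holN ((embExt (InPortionThree (isArc := isArc) v) (.nv v)).obj a') (isHolomorphic_embExt_obj v a')) := by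
  cases a' with
  | base a =>
    obtain ⟨x, hx⟩ := a
    cases x with
    | row1 k => exact HEq.rfl
    | core => exact HEq.rfl
    | nplus w => exact HEq.rfl
    | nv w => exact absurd hx (nv_not_mem_portion v w)
    | _ => exact absurd hx (by rintro (⟨hh, hr⟩ | h) <;> [simp [DVertex.IsHolomorphic, DVertex.row] at hh hr; cases h])
  | obs => exact HEq.rfl

/-- Arrow by arrow: the over-isomorphism of `logTSOverE v` whiskered by `T` is abc-iut-f-102's `holμ lamOver logOver`
(both are `logOver` for `log`, unitors for `id_⋎`, `lamOver` for `λ⊞_{v,ν}`, identities for `𝒩⊞_v → 𝒩_v`).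
[cite: MochizukiAbsTopIII2015, Def 5.4 (iv) p. 127] -/
theorem logTSOverE_μ_whiskerRight_T_heq {a' b' : (logShapeTS (isArc := isArc) v).Vertex} (e : a' ⟶ b') :
    HEq (Functor.isoWhiskerRight ((L.logTSOverE v).μ e) (L.κAn.functor ⋙ L.κAn₂.functor))
      (L.holμ L.lamOverData L.logOver ((embExt (InPortionThree (isArc := isArc) v) (.nv v)).map e)
        (isHolomorphic_embExt_obj v a') (isHolomorphic_embExt_obj v b')) := by
  cases a' with
  | base a =>
    cases b' with
    | base b =>
      obtain ⟨x, hx⟩ := a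
      obtain ⟨y, hy⟩ := b
      change DEdge isArc x y at e
      cases e with
      | log n =>
        apply heq_of_eq; ext X
        simp [logTSOverE, tsμ, holμ, embExt]
        erw [Category.id_comp]
        rfl
      | toCore n =>
        apply heq_of_eq; ext X
        simp [logTSOverE, tsμ, holμ, holN, embExt]
        erw [CategoryTheory.Functor.map_id, CategoryTheory.Functor.map_id]
        rfl
      | lam w ν hν =>
        apply heq_of_eq; ext X
        simp [logTSOverE, tsμ, holμ, lamOverData, embExt]
        erw [Category.id_comp]
        rfl
      | forget w => exact absurd hy (nv_not_mem_portion v w)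
      | _ => exact absurd hy (by rintro (⟨hh, hr⟩ | h) <;> [simp [DVertex.IsHolomorphic, DVertex.row] at hh hr; cases h])
    | obs =>
      obtain ⟨x, hx⟩ := a
      change DEdge isArc x (.nv v) at e
      cases e
      apply heq_of_eq; ext X
      simp [logTSOverE, tsμObs, holμ, embExt]
      erw [CategoryTheory.Functor.map_id, CategoryTheory.Functor.map_id]
      rfl
  | obs =>
    cases b' with
    | base b => exact PEmpty.elim e
    | obs => exact PEmpty.elim e

/-- ★ **`logTSOverE v` post-composed with `T = κ_{An•} ⋙ κ₂` IS abc-iut-f-102's `holOverData lamOver logOver` restricted to the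
portion** (heterogeneously, along `logDiagramTS_eq_comapAlong_embHolTS`). [cite: MochizukiAbsTopIII2015, Remark 3.5.1 p.78] -/
theorem logTSOverE_map_heq_holOverData :
    HEq ((L.logTSOverE v).map (L.κAn.functor ⋙ L.κAn₂.functor))
      ((L.holOverData L.lamOverData L.logOver).comapAlong (embHolTS (isArc := isArc) v)) :=
  OverData.heq_of_eq (L.logDiagramTS_eq_comapAlong_embHolTS v) (fun a' => L.logTSOverE_N_comp_T_heq v a')
    (fun _ _ e => L.logTSOverE_μ_whiskerRight_T_heq v e)

end OverDataComparison

/-! ## §3. A `TS`-homotopy over `Th•[Z]`, pushed into a core vertex, is the core homotopy -/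

section Core

variable (Hts : ∀ v : Vmod, (L.logDiagramTS v).HomotopyFamily) (v : Vmod)

/-- the boundary pair of `Hts v` read on the restricted diagram (B1's `tsLiftFamily`). [cite: MochizukiAbsTopIII2015, Definition 3.5 (ii) p.75] -/
theorem tsLiftFamily_E_of_mem {a' : (logShapeTS (isArc := isArc) v).Vertex} {p q : Path a' (logShapeTS (isArc := isArc) v).obs}
    (mem : (Hts v).E p q) : (L.tsLiftFamily Hts v).E p q :=
  (HomotopyFamily.cast_E_iff (L.extend_eq_comapAlong (InPortionThree v) (.nv v)) (Hts v) p q).mpr mem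

/-- **A `TS`-homotopy lying over `Th•[Z]` lies, read in the holomorphic sub-diagram, over abc-iut-f-102's `holOverData lamOver
logOver`** (through `T`, which only relabels `ℰ•`: abc-iut-L4-t12's `IsOver.map`, then §2 along the identification of the
diagrams, then along the restriction). [cite: MochizukiAbsTopIII2015, Remark 3.5.1 p.78] -/
theorem isOver_holOverData_of_isOver {a' : (logShapeTS (isArc := isArc) v).Vertex}
    {p q : Path a' (logShapeTS (isArc := isArc) v).obs} (mem : (Hts v).E p q)
    (hover : (L.logTSOverE v).IsOver p q ((Hts v).η mem)) :
    (L.holOverData L.lamOverData L.logOver).IsOver ((embHolTS (isArc := isArc) v).mapPath p)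
      ((embHolTS (isArc := isArc) v).mapPath q)
      (eqToHom ((L.subdiagram DVertex.IsHolomorphic).pathFunctor_comapAlong (embHolTS v) p).symm ≫
        (L.tsLiftFamily Hts v).η (L.tsLiftFamily_E_of_mem Hts v mem) ≫
        eqToHom ((L.subdiagram DVertex.IsHolomorphic).pathFunctor_comapAlong (embHolTS v) q)) := by
  have h1 := hover.map (L.κAn.functor ⋙ L.κAn₂.functor)
  have h2 : ((L.holOverData L.lamOverData L.logOver).comapAlong (embHolTS (isArc := isArc) v)).IsOver p q
      ((L.tsLiftFamily Hts v).η (L.tsLiftFamily_E_of_mem Hts v mem)) :=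
    (isOver_cast_iff' (L.logDiagramTS_eq_comapAlong_embHolTS v) (L.logTSOverE_map_heq_holOverData v)
      (HomotopyFamily.cast_η_heq (L.extend_eq_comapAlong (InPortionThree v) (.nv v)) (Hts v)
        (L.tsLiftFamily_E_of_mem Hts v mem)).symm).mp h1
  exact isOver_of_isOver_comapAlong _ _ p q _ h2

/-- ★ **The core homotopy of a whiskered `TS`-pair IS the whiskered `TS`-homotopy** (for a boundary pair `(p, q)` of `Hts v`
whose homotopy lies over `Th•[Z]`, and any path `[t] : 𝒩_v → ⋯` into a core vertex): abc-iut-f-102's `coreLift lamOver logOver`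
of the pair `([t]∘[p], [t]∘[q])` read on `D•⊢` equals, heterogeneously, the homotopy of `Hts v` read on `D•⊢` (B1's `liftη`)
whiskered by `𝒟_{[t]}` — uniqueness of transformations over `Th•[Z]` through the fully faithful structure functor at the core
(abc-iut-L4-t12's `IsOver.whiskerRight`, `IsOver.eq_lift`). [cite: MochizukiAbsTopIII2015, Remark 3.5.1 p.78] -/
theorem coreLift_comp_heq_whiskerRight_of_isOver {a' : (logShapeTS (isArc := isArc) v).Vertex}
    {p q : Path a' (logShapeTS (isArc := isArc) v).obs} (mem : (Hts v).E p q)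
    (hover : (L.logTSOverE v).IsOver p q ((Hts v).η mem)) {w' : DVertex Vmod isArc} (hw' : IsCoreVertex w')
    (t : Path (DVertex.nv v : DVertex Vmod isArc) w') :
    HEq (L.coreLift L.lamOverData L.logOver hw'
        (((embExt (InPortionThree (isArc := isArc) v) (.nv v)).mapPath p).comp t)
        (((embExt (InPortionThree (isArc := isArc) v) (.nv v)).mapPath q).comp t))
      (Functor.whiskerRight
        (liftη (embExt (InPortionThree (isArc := isArc) v) (.nv v)) L.diagram (logShapeTS (isArc := isArc) v).obs
          (L.tsLiftFamily Hts v) ⟨LiftPair.ofMem (L.tsLiftFamily_E_of_mem Hts v mem)⟩)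
        (L.diagram.pathFunctor t)) := by
  -- abbreviations
  have hF := graphEmbedding_embExt_nv (isArc := isArc) v
  -- (1) over-ness in the holomorphic sub-diagram, whiskered along the lift of `t`
  have h3 := (L.isOver_holOverData_of_isOver Hts v mem hover).whiskerRight (holLift t (isHolomorphic_of_isCoreVertex hw'))
  -- (2) re-index the pair as the holomorphic lift of the `D•⊢` pair
  have hP : ((embHolTS (isArc := isArc) v).mapPath p).comp (holLift t (isHolomorphic_of_isCoreVertex hw')) =
      holLift (((embExt (InPortionThree (isArc := isArc) v) (.nv v)).mapPath p).comp t) (isHolomorphic_of_isCoreVertex hw') := by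
    rw [← holLift_mapPath_embExt v p]
    exact (DSub.liftPath_comp DVertex.isHolomorphic_of_hom _ t _).symm
  have hQ : ((embHolTS (isArc := isArc) v).mapPath q).comp (holLift t (isHolomorphic_of_isCoreVertex hw')) =
      holLift (((embExt (InPortionThree (isArc := isArc) v) (.nv v)).mapPath q).comp t) (isHolomorphic_of_isCoreVertex hw') := by
    rw [← holLift_mapPath_embExt v q]
    exact (DSub.liftPath_comp DVertex.isHolomorphic_of_hom _ t _).symm
  have h4 := h3.congr hP hQ
  -- (3) uniqueness at the core: the whiskered homotopy is the lift, i.e. `coreLift`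
  have h5 := h4.eq_lift (L.holN_fullyFaithful w' hw')
  refine (L.coreLift_heq_lift L.lamOverData L.logOver hw' _ _).trans ?_
  refine (heq_of_eq h5).symm.trans ?_
  -- (4) strip the `eqToHom` book-ends and compare the whiskerings heterogeneously
  refine (HomotopyFamily.heq_eqToHom_comp_comp_eqToHom _ _ _).trans ?_
  refine (HomotopyFamily.heq_eqToHom_comp_comp_eqToHom _ _ _).trans ?_
  refine whiskerRight_heq_whiskerRight ?_ ?_ ?_ (L.pathFunctor_eq_holLift t (isHolomorphic_of_isCoreVertex hw')).symm
  · exact ((L.subdiagram DVertex.IsHolomorphic).pathFunctor_comapAlong (embHolTS v) p).symm.trans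
      (L.diagram.pathFunctor_comapAlong (embExt (InPortionThree (isArc := isArc) v) (.nv v)) p)
  · exact ((L.subdiagram DVertex.IsHolomorphic).pathFunctor_comapAlong (embHolTS v) q).symm.trans
      (L.diagram.pathFunctor_comapAlong (embExt (InPortionThree (isArc := isArc) v) (.nv v)) q)
  · refine (HomotopyFamily.heq_eqToHom_comp_comp_eqToHom _ _ _).trans ?_
    rw [liftη_eq hF _ (LiftPair.ofMem (L.tsLiftFamily_E_of_mem Hts v mem)), LiftPair.hom_ofMem]
    exact (HomotopyFamily.heq_eqToHom_comp_comp_eqToHom _ _ _).symm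

/-- ★ **The cross law `𝒩_v → core` for B1's datum, homotopy part**: for a related pair `(P, Q)` at the pivot `𝒩_v` of
`tsRelLifts Hts` whose `TS`-homotopies lie over `Th•[Z]` (hypothesis `hover` on all boundary pairs of `Hts v`, as abc-iut-w5-d144's
`isOver_logObsFamilyTS_η` provides at the carriers) and any path `[t]` from `𝒩_v` into a core vertex, abc-iut-f-102's core
homotopy of `([t]∘P, [t]∘Q)` is the datum's homotopy whiskered by `𝒟_{[t]}`. [cite: MochizukiAbsTopIII2015, Cor 5.5 (iii) p. 131] -/
theorem tsRelLifts_θ_cross_core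
    (hover : ∀ (v : Vmod) {a' : (logShapeTS (isArc := isArc) v).Vertex}
      {p q : Path a' (logShapeTS (isArc := isArc) v).obs} (h : (Hts v).E p q), (L.logTSOverE v).IsOver p q ((Hts v).η h))
    {a : DVertex Vmod isArc} {P Q : Path a (DVertex.nv v)} (h : (L.tsRelLifts Hts).Rel P Q)
    {w' : DVertex Vmod isArc} (hw' : IsCoreVertex w') (t : Path (DVertex.nv v : DVertex Vmod isArc) w') :
    HEq (L.coreLift L.lamOverData L.logOver hw' (P.comp t) (Q.comp t))
      (Functor.whiskerRight ((L.tsRelLifts Hts).θ (L.tsRelLifts_W_nv Hts v) h) (L.diagram.pathFunctor t)) := by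
  obtain ⟨w⟩ := h
  obtain ⟨src, left, right, mem', hs, hl, hr⟩ := w
  subst hs
  cases hl
  cases hr
  have mem : (Hts v).E left right :=
    (HomotopyFamily.cast_E_iff (L.extend_eq_comapAlong (InPortionThree v) (.nv v)) (Hts v) left right).mp mem'
  rw [tsRelLifts_θ_eq]
  exact L.coreLift_comp_heq_whiskerRight_of_isOver Hts v mem (hover v mem) hw' t

end Core

end LogFrobeniusSetting

end Literature.AnabelianGeometry.AbsoluteAnabelian
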